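import Literature.Analysis.FluidPDE.KNSSThm53OfWindow
import Literature.Analysis.FluidPDE.LeiZhang2011Setting
import HarnessLib

/-!
# Lei–Zhang 2011, Theorem 1.1 — step 0: the equation for `Γ = r v^θ` along a continuous
# bounded weak ancient axisymmetric solution

Analysis/FluidPDE **proofs file** (theorems only: no definitions, no named facts, no `sorry`),
first step of the programme formalizing Theorem 1.1 of Z. Lei, Q. S. Zhang, J. Funct. Anal. 261
(2011) = arXiv:1011.5066 (Hölder continuity of `Γ = r v^θ` at the axis for drifts in the class
`E`; the remaining hypothesis `hHolder` of `LeiZhang2011RegularityUniform` on the discharge path of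
`Literature.Analysis.FluidPDE.LeiZhang2011_regularity_bmoStream`). The paper works with "a
positive solution `Φ` to (1.5) `∂ₜΓ + b·∇Γ + (2/r)∂ᵣΓ = ΔΓ` in `P(R)`" (§§2–3). For the class
of solutions on which `hHolder` is stated — bounded weak solutions of Navier–Stokes on
`ℝ³ × (−∞, 0)`, jointly continuous, with axisymmetric slices — the tree's proved KNSS 2009 §4
package `KNSS2009_regularity_axisymmetric_swirl_holds` supplies a smooth axisymmetric
representative `U` and a bounded axial parasitic part `β(t) e₃`, with `Γ = swirl (U t)` solving
(1.5) = KNSS (5.10) off the axis in time-integrated form. This file upgrades it for **continuous**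
`v`:

* `exists_smooth_rep_swirl_equation_of_continuous` — there are `U` (smooth slices, all `∇ᵏU`
  bounded and Lipschitz in time, divergence free, axisymmetric) and a *continuous* bounded `γ` with
  `v(t, x) = U(t, x) + γ(t) e₃` for **every** `t < 0` and `x`, hence `Γ_v = swirl (v t) = swirl (U t)`,
  and `Γ(t, x) − Γ(s, x) = ∫ₛᵗ (ΔΓ − DΓ[v(τ, x)] − (2/r) ∂ᵣΓ)(τ, x) dτ` off the axis — the drift
  being the continuous field `v` itself, i.e. `b = v^r e_r + v^z e_z` of (1.1) up to the
  `e_θ`-component, which does not act on the axisymmetric `Γ`.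

## References

* Z. Lei, Q. S. Zhang, J. Funct. Anal. 261 (2011) = arXiv:1011.5066: (1.5) p. 2, Thm. 1.1 p. 3,
  §2 p. 6. [LeiZhang2011]
* G. Koch, N. Nadirashvili, G. Seregin, V. Šverák, Acta Math. 203 (2009), §4 and (5.10).
  [KochNadirashviliSereginSverak2009]
-/

noncomputable section

open MeasureTheory Set Function Filter Topology TopologicalSpace Metric
open scoped InnerProductSpace RealInnerProductSpace NNReal Laplacian ContDiff

namespace Literature.Analysis.FluidPDE

open SereginSverak2009

/-- **The smooth representative and the equation for `Γ` along a continuous bounded weak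
ancient axisymmetric solution.** Let `v` be a bounded weak solution of Navier–Stokes (`ν = 1`)
on `ℝ³ × (−∞, 0)`, jointly continuous, with axisymmetric slices. Then there are
`U : ℝ → ℝ³ → ℝ³` and a continuous bounded `γ : ℝ → ℝ` such that `v(t, x) = U(t, x) + γ(t) e₃`
for all `t < 0`, `x`; every slice `U(t, ·)`, `t < 0`, is smooth, divergence free and
axisymmetric, with `‖∇ᵏU‖ ≤ C_k` and `‖∇ᵏU(t, x) − ∇ᵏU(s, x)‖ ≤ L_k |t − s|`; `swirl (v t) =
swirl (U t)`; and `Γ = swirl (U t)` satisfies KNSS (5.10) = Lei–Zhang (1.5) off the axis in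
time-integrated form with drift `v`:
`Γ(t,x) − Γ(s,x) = ∫ₛᵗ (ΔΓ − DΓ[v(τ,x)] − (2/r) ∂ᵣΓ)(τ, x) dτ`, `r(x) ≠ 0`, `s ≤ t < 0`
(`KNSS2009_regularity_axisymmetric_swirl_holds`; the a.e. identities are upgraded by continuity:
a.e.-equal continuous slices agree, the good times are dense, and `v − U` is continuous in time).
[cite: LeiZhang2011, (1.5) (arXiv p. 2) and Thm. 1.1 (p. 3)] -/
theorem exists_smooth_rep_swirl_equation_of_continuous
    {v : ℝ → EuclideanSpace ℝ (Fin 3) → EuclideanSpace ℝ (Fin 3)}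
    (hweak : IsBoundedWeakNSSolutionOn (Iio 0) isOpen_Iio 1 v) (hcont : Continuous (uncurry v))
    (haxi : ∀ t < 0, IsAxisymmetric (v t)) :
    ∃ (U : ℝ → EuclideanSpace ℝ (Fin 3) → EuclideanSpace ℝ (Fin 3)) (γ : ℝ → ℝ),
      ContinuousOn γ (Iio 0) ∧ (∃ C : ℝ, ∀ t < 0, |γ t| ≤ C) ∧
      (∀ t < 0, ∀ x, v t x = U t x + γ t • eZ) ∧
      (∀ t < 0, ContDiff ℝ ∞ (U t)) ∧ (∀ t < 0, VectorCalculus.IsDivFree (U t)) ∧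
      (∀ t < 0, IsAxisymmetric (U t)) ∧
      (∀ k : ℕ, ∃ C : ℝ, ∀ t < 0, ∀ x, ‖iteratedFDeriv ℝ k (U t) x‖ ≤ C) ∧
      (∀ k : ℕ, ∃ L : ℝ, ∀ s < 0, ∀ t < 0, ∀ x,
        ‖iteratedFDeriv ℝ k (U t) x - iteratedFDeriv ℝ k (U s) x‖ ≤ L * |t - s|) ∧
      (∀ t < 0, ∀ x, swirl (v t) x = swirl (U t) x) ∧
      (∀ x, cylRadius x ≠ 0 → ∀ s t : ℝ, s ≤ t → t < 0 →
        swirl (U t) x - swirl (U s) x =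
          ∫ τ in s..t, ((Δ (swirl (U τ))) x - fderiv ℝ (swirl (U τ)) x (v τ x) -
            2 / cylRadius x * partialDeriv (eR x) (swirl (U τ)) x)) := by
  -- the KNSS §4 package for the `L^∞`-axisymmetric bounded weak solution `v`
  have haxiL : ∀ θ : ℝ, ∀ᵐ t ∂((volume : Measure ℝ).restrict (Iio 0)),
      (fun x => v t (rotZ θ x)) =ᵐ[volume] fun x => rotZ θ (v t x) := fun θ => by
    filter_upwards [ae_restrict_mem measurableSet_Iio] with t ht
    exact Eventually.of_forall fun x => haxi t ht θ x
  obtain ⟨U, β, -, ⟨Cβ, hCβ⟩, -, hae, hsm, hdiv, hUaxi, hbd, hlip, heq⟩ :=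
    KNSS2009_regularity_axisymmetric_swirl_holds hweak haxiL
  -- the difference `w = v − U` is continuous in time on `(−∞, 0)` for each `x`
  obtain ⟨L₀, hL₀⟩ := hlip 0
  have hUt : ∀ x, ∀ s < 0, ∀ t < 0, ‖U t x - U s x‖ ≤ L₀ * |t - s| := fun x s hs t ht => by
    have h := hL₀ s hs t ht x
    simpa only [iteratedFDeriv_zero_eq_comp, Function.comp_apply, ← map_sub,
      LinearIsometryEquiv.norm_map] using h
  have hUc : ∀ x, ContinuousOn (fun t => U t x) (Iio 0) := by
    intro x t₀ ht₀
    rw [Metric.continuousWithinAt_iff]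
    intro ε hε
    refine ⟨ε / (|L₀| + 1), by positivity, fun t ht hdist => ?_⟩
    rw [dist_eq_norm]
    calc ‖U t x - U t₀ x‖ ≤ L₀ * |t - t₀| := hUt x t₀ ht₀ t ht
      _ ≤ |L₀| * |t - t₀| := mul_le_mul_of_nonneg_right (le_abs_self _) (abs_nonneg _)
      _ < |L₀| * (ε / (|L₀| + 1)) + 1 * (ε / (|L₀| + 1)) := by
          have hd : |t - t₀| < ε / (|L₀| + 1) := by rwa [Real.dist_eq] at hdist
          have hpos : 0 < ε / (|L₀| + 1) := by positivity
          have h1 : |L₀| * |t - t₀| ≤ |L₀| * (ε / (|L₀| + 1)) :=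
            mul_le_mul_of_nonneg_left hd.le (abs_nonneg _)
          linarith
      _ = ε := by field_simp
  have hvc : ∀ x, Continuous fun t => v t x := fun x =>
    hcont.comp (continuous_id.prodMk continuous_const)
  have hwc : ∀ x, ContinuousOn (fun t => v t x - U t x) (Iio 0) := fun x =>
    (hvc x).continuousOn.sub (hUc x)
  -- at a.e. `t < 0`: `v t = U t + β t e₃` everywhere in `x`
  have hgood : ∀ᵐ t ∂((volume : Measure ℝ).restrict (Iio 0)), ∀ x, v t x - U t x = β t • eZ := by
    filter_upwards [hae, ae_restrict_mem measurableSet_Iio] with t ht htI x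
    have hc1 : Continuous (v t) := hcont.comp (Continuous.prodMk_right t)
    have hc2 : Continuous fun x => U t x + β t • eZ := (hsm t htI).continuous.add continuous_const
    have h : v t x = U t x + β t • eZ := congrFun (eq_of_ae_eq_of_continuous hc1 hc2 ht) x
    rw [h]; abel
  -- hence, by continuity in time, `v t x − U t x` does not depend on `x` and is axial, all `t < 0`
  have hindep : ∀ x, ∀ t < 0, v t x - U t x = v t 0 - U t 0 := by
    intro x t ht
    have hae' : ∀ᵐ s ∂((volume : Measure ℝ).restrict (Iio 0)), v s x - U s x = v s 0 - U s 0 := by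
      filter_upwards [hgood] with s hs
      rw [hs x, hs 0]
    exact Measure.eqOn_open_of_ae_eq hae' isOpen_Iio (hwc x) (hwc 0) ht
  have hcoord : ∀ i : Fin 3, i ≠ 2 → ∀ t < 0, (v t 0 - U t 0) i = 0 := by
    intro i hi t ht
    have hae' : ∀ᵐ s ∂((volume : Measure ℝ).restrict (Iio 0)), (v s 0 - U s 0) i = 0 := by
      filter_upwards [hgood] with s hs
      rw [hs 0]
      fin_cases i <;> simp [eZ] at hi ⊢
    exact forall_eq_zero_of_ae_restrict_Iio
      (((PiLp.continuous_apply 2 _ i).comp_continuousOn (hwc 0))) hae' t ht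
  -- the axial part `γ`
  set γ : ℝ → ℝ := fun t => (v t 0 - U t 0) 2 with hγ
  have hwγ : ∀ t < 0, v t 0 - U t 0 = γ t • eZ := by
    intro t ht
    ext i
    fin_cases i
    · simpa [eZ] using hcoord 0 (by decide) t ht
    · simpa [eZ] using hcoord 1 (by decide) t ht
    · simp [hγ, eZ]
  have hrep : ∀ t < 0, ∀ x, v t x = U t x + γ t • eZ := fun t ht x => by
    rw [← hwγ t ht, ← hindep x t ht]; abel
  have hγc : ContinuousOn γ (Iio 0) := (PiLp.continuous_apply 2 _ 2).comp_continuousOn (hwc 0)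
  -- `γ = β` at a.e. `t < 0`, so `|γ| ≤ Cβ` everywhere by continuity (closed condition)
  have hγβ : ∀ᵐ t ∂((volume : Measure ℝ).restrict (Iio 0)), γ t = β t := by
    filter_upwards [hgood, ae_restrict_mem measurableSet_Iio] with t ht htI
    have h := congrFun (congrArg (⇑) ((hwγ t htI).symm.trans (ht 0))) 2
    simpa [eZ] using h
  have hγbd : ∀ t < 0, |γ t| ≤ Cβ := by
    intro t ht
    have hae' : ∀ᵐ s ∂((volume : Measure ℝ).restrict (Iio 0)), min (Cβ - |γ s|) 0 = 0 := by
      filter_upwards [hγβ] with s hs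
      rw [hs]
      exact min_eq_right (sub_nonneg.2 (hCβ s))
    have hc : ContinuousOn (fun s => min (Cβ - |γ s|) 0) (Iio 0) := by
      have hm : Continuous fun r : ℝ => min (Cβ - |r|) 0 :=
        (continuous_const.sub continuous_abs).min continuous_const
      exact hm.comp_continuousOn hγc
    have h0 := forall_eq_zero_of_ae_restrict_Iio (F := ℝ) hc hae' t ht
    have : Cβ - |γ t| ≥ 0 := by
      by_contra hlt
      push Not at hlt
      rw [min_eq_left hlt.le] at h0
      linarith
    linarith
  -- the swirl and its equation with drift `v`
  have hswirl : ∀ t < 0, ∀ x, swirl (v t) x = swirl (U t) x := fun t ht x => by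
    rw [show v t = fun y => U t y + γ t • eZ from funext (hrep t ht)]
    exact LeiZhang2011.swirl_add_smul_eZ (U t) (γ t) x
  refine ⟨U, γ, hγc, ⟨Cβ, hγbd⟩, hrep, hsm, hdiv, hUaxi, hbd, hlip, hswirl, fun x hx s t hst ht => ?_⟩
  rw [heq x hx s t hst ht]
  refine intervalIntegral.integral_congr_ae ?_
  have hG : ∀ᵐ τ ∂(volume : Measure ℝ), τ ∈ Iio (0 : ℝ) → ∀ y, v τ y - U τ y = β τ • eZ :=
    (ae_restrict_iff' measurableSet_Iio).1 hgood
  filter_upwards [hG] with τ hτ hτmem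
  have hτ0 : τ < 0 := by
    rw [Set.uIoc_of_le hst] at hτmem
    exact hτmem.2.trans_lt ht
  have h1 : U τ x + β τ • eZ = v τ x := by rw [← hτ hτ0 x]; abel
  rw [h1]

end Literature.Analysis.FluidPDE
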